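import Summits.MatrixMultiplication.MatrixMultiplication.Theorems.AbelianSTPPCensusTAStatDefs
import Summits.MatrixMultiplication.MatrixMultiplication.Theorems.AbelianSTPPCensusTB5StatData
import Summits.MatrixMultiplication.MatrixMultiplication.Theorems.AbelianSTPPCensusTB5GainTable2375
import Summits.MatrixMultiplication.MatrixMultiplication.Theorems.AbelianSTPPCensusTAStatKMemberX

/-!
# T_B static certificate, range `5995 … 6012`: theory's t*-indexed linear checker with the k-member bucket-descent tree at `τ = 2375/1000` (definitions)

Cell mm-stpp (rung F-M1), tier T_B = «beat `2.375` (Coppersmith–Winograd)»; successor kernel item of the closed crux item stmt-MatrixMultiplication-19191, seat mm-stpp-vp-p2 (gen 7); fifth T_B range after `AbelianSTPPCensusLeafTB5994Closed.lean` (vp-p2 gen 6, universe `5994`, the same multi-parameter tree; PRE-REG v1 band B1 of the STPP census).  This file is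
theory g12's `AbelianSTPPCensusTAStatDDefs.lean` (fourth T_A range; design `AbelianSTPPCensusTAStatDefs.lean`, theory g11) with the range constants and the gain
exchanged — universe `Mtop = 6012`, orders `lo = 5995 … 6012`, table `TB5StatData.E` (48 levels × 74 buckets), gains `ShapeCert.gainOfTBV`
(`AbelianSTPPCensusTB5GainTable2375.lean`), budget parameter of a bucket = its lower end (`tp = tb`) — and ONE structural change: the fallback of a failing one-member
`cover` in the bucket walk is the k-member bucket-descent TREE WITH SEVERAL GRYNKIEWICZ PARAMETERS PER NODE `TAStatKM.coverKX` of `AbelianSTPPCensusTAStatKMemberX.lean` (vp-p2 gen 6; extra entries `xrow`, levels `≥ ix0`, buckets `≥ jx0`) (at most `kmax = 10` explicit members;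
the bucket lists `TB5StatData.M2` are complete for EVERY bucket, checked by `m2V`), i.e. the walk is `TAStatKM.walk4`.  The data-free parts (`TAStat.tm`, `e0`, `domP`,
`leP`, `leW`, `vpI`, `p1I`, `p2I`, `p3I`, `piece`, `pcs`, `vpCand`, `vpThresh`, `cover`; `TAStat2M.tiOK`; `TAStatKM.testKX/goI/treeKX/rootKX/coverKX/walk4`) are reused by name.
Exact integer twin: seat twin/tastat8.py (run `tb_6012_60_K10_geom1.1_tbj_xj77_xt128_136_144_160 (kit j314355)`, `JOB_K=10`, bucket parameter `TB[j]` plus the extra parameters `[160, 144, 136, 128]` at levels `≥ 36`, buckets `≥ 61`: all 1828011 (shape, bucket) cells of the orders `5995 … 6012` pass,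
138 of them through the tree with 5785376 tree nodes in all; PRE-REG v1 band B1: with the registered parameters (kmax = 10, extra parameters t′ ∈ {128,136,144,160} at levels ≥ 36, buckets ≥ 61) the tree's first uncovered order is `6013` (cell `(14,16,16)`, bucket `[220,246]`, kit j314177); almost all tree work of this range sits in that one cell (5.2 M of 5.8 M nodes; up to 4.4·10⁵ nodes at a single order, kernel-checked in `goIR` pieces of ≤ 4·10⁴ nodes assembled by `AbelianSTPPCensusTAStatKMemberXSplit.lean` / `…XWalk.lean`); with extra parameters down to t′ = 112 at buckets ≥ 60 the twin passes to ≥ 6031 at 32.7 M nodes and the cell `(15,15,16)` explodes from 6024 on (3.7·10⁶ nodes at the single order 6031); no admissible beating list is known (kit wall search j306809/j307021, vp-p2 g6: none ≤ 6039)).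
Soundness: `AbelianSTPPCensusTB5Stat{Rows,Rows2,Sound}.lean`; kernel evaluations `…TB5StatDom*/Ck*`; leaf `AbelianSTPPCensusLeafTB6012Closed.lean` (`noAbelianSTPPHostUpTo_2375_6012`).
WHAT THIS IS NOT: no statement about STPP families or `ω` — arithmetic on shape lists only; nothing about orders `> 6012` or `< 5995`.
-/

set_option linter.dupNamespace false
set_option autoImplicit false

namespace Summit.MatrixMultiplication.MatrixMultiplication.Theorems.TB5Stat

open TECert (tableOK vol us)
open ShapeCert (gainOfTBV D)
open TB5StatData (E VL TB M2 M2F XR nl nb)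
open TAStat (tm Entry e0 domP leP leW vpI p1I p2I p3I piece pcs vpCand vpThresh cover)

/-! ## Parameters -/

/-- Largest order of the certificate (= the order of the single-member table defining the candidate shapes). -/
def Mtop : ℕ := 6012
/-- Least order of this range (orders `≤ 5994`: `noAbelianSTPPHostUpTo_2375_5994`). -/
def lo : ℕ := 5995
/-- Number of sub-intervals of orders on which the vM bound is re-checked by endpoint evaluation when one interval does not suffice. -/
def J : ℕ := 12
/-- Largest number of explicit members in a tree node (the maximal member and `kmax − 1` companions). -/
def kmax : ℕ := 10

/-! ## Candidate shapes (sorted), levels and buckets -/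

/-- The sorted candidate shapes `(a, b, c)`, `a ≤ b ≤ c`, of volume exactly `V`, passing `TECert.tableOK` at order `Mtop`
(`a ≤ 18`, `b ≤ 77` suffice since `19³ = 6859 > Mtop` and `78² = 6084 > Mtop`). -/
def triplesS (V : ℕ) : List (ℕ × ℕ × ℕ) :=
  (List.range 18).flatMap fun a' =>
    if V % (a' + 1) = 0 then
      (List.range 77).filterMap fun b' =>
        if a' ≤ b' ∧ V / (a' + 1) % (b' + 1) = 0 ∧ b' + 1 ≤ V / (a' + 1) / (b' + 1) ∧
            tableOK Mtop (a' + 1) (b' + 1) (V / (a' + 1) / (b' + 1)) = true then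
          some (a' + 1, b' + 1, V / (a' + 1) / (b' + 1))
        else none
    else []

/-- level of a volume: the first index `i` with `V ≤ VL[i]` (`VL.length` if none). -/
def levOf (V : ℕ) : ℕ := VL.findIdx fun vl => decide (V ≤ vl)

/-- bucket of a parameter `t ≥ 1`: the last index `j` with `TB[j] ≤ t` (computed as (first index with `t < TB[j]`) − 1). -/
def bucketOf (t : ℕ) : ℕ := (TB.findIdx fun b => decide (t < b)) - 1

/-- lower end `TB[j]` of bucket `j` (default `1000` beyond the list, which keeps `tb` monotone and below `10⁶` everywhere — the form the tree's soundness consumes) -/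
def tb (j : ℕ) : ℕ := TB.getD j 1000

/-- budget parameter of bucket `j`: in this range the bucket's own lower end `TB[j]` (the `TP`-clauses of `monoOK` hold trivially) -/
def tp (j : ℕ) : ℕ := tb j

/-- second-member list of bucket `j` (default `[]`) -/
def m2l (j : ℕ) : List (ℕ × ℕ × ℕ) := M2.getD j []

/-- list flag of bucket `j` (default `false`): `M2[j]` is complete for the bucket (here every bucket `< nb`) -/
def m2f (j : ℕ) : Bool := M2F.getD j false

/-! ## The table entries -/

/-- entry `(i, j)` of the table -/
def ent (i j : ℕ) : Entry := (E.getD i []).getD j e0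

/-- the table row of the level of a volume `V`, as a function of the bucket (read by the tree at every bucket it visits) -/
def rowOf (V : ℕ) (j : ℕ) : Entry := (E.getD (levOf V) []).getD j e0

/-- first level carrying extra U11-G parameters -/
def ix0 : ℕ := 36
/-- first bucket carrying extra U11-G parameters -/
def jx0 : ℕ := 61

/-- the extra U11-G entries `(t′, gW′, wW′)` of level `i`, bucket `j` (empty below level `ix0` or bucket `jx0`) -/
def xrow (i j : ℕ) : List (ℕ × ℕ × ℕ) := if ix0 ≤ i ∧ jx0 ≤ j then (XR.getD (i - ix0) []).getD (j - jx0) [] else []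

/-- the extra entries read by the tree for a maximal member of volume `V` (the level of `V`), as a function of the bucket -/
def xrowOf (V : ℕ) (j : ℕ) : List (ℕ × ℕ × ℕ) := xrow (levOf V) j

/-- U11-G domination of a shape (gain `g`, volume `V`, pair-product sum `p`) along a table row from bucket `j` on, each entry read at its own bucket
budget parameter `t = TP[j]`: `V < t·p` and `g·wW ≤ gW·(t·p − V)`. -/
def domWrow (g V p : ℕ) : List Entry → ℕ → Bool
  | [], _ => true
  | e :: es, j => Nat.blt V (tp j * p) && Nat.ble (g * e.2.2.2) (e.2.2.1 * (tp j * p - V)) && domWrow g V p es (j + 1)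

/-- domination of one sorted candidate shape `x` of volume `V` (gain `g`): vM at its own (level, bucket), U11-G at its own level and every bucket
from its own on. -/
def domX (V g : ℕ) (x : ℕ × ℕ × ℕ) : Bool :=
  domP g (us x) ((E.getD (levOf V) []).getD (bucketOf (tm x)) e0) &&
    domWrow g V (us x) ((E.getD (levOf V) []).drop (bucketOf (tm x))) (bucketOf (tm x))

/-- every sorted candidate shape of the volumes `V, …, V + n − 1` is dominated (`domX`) -/
def domV : ℕ → ℕ → Bool
  | 0, _ => true
  | n + 1, V => (triplesS V).all (domX V (gainOfTBV V)) && domV n (V + 1)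

/-- domination of a shape (gain `g`, volume `V`, pair-product sum `p`) at every extra entry `(t′, gW′, wW′)` of a list: `V < t′·p` and
`g·wW′ ≤ gW′·(t′·p − V)`. -/
def domXTrow (g V p : ℕ) (xs : List (ℕ × ℕ × ℕ)) : Bool :=
  xs.all fun e => Nat.blt V (e.1 * p) && Nat.ble (g * e.2.2) (e.2.1 * (e.1 * p - V))

/-- domination of one sorted candidate shape `x` of volume `V` (gain `g`) at the extra entries of level `i`, every bucket `≥ jx0` from that of `tm x` on -/
def domXT (i V g : ℕ) (x : ℕ × ℕ × ℕ) : Bool :=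
  (List.range (nb - jx0)).all fun j' => Nat.blt (jx0 + j') (bucketOf (tm x)) || domXTrow g V (us x) (xrow i (jx0 + j'))

/-- … at the extra entries of EVERY level `≥ ix0` whose volume bound covers `V` -/
def domXTall (V g : ℕ) (x : ℕ × ℕ × ℕ) : Bool :=
  (List.range (nl - ix0)).all fun i' => Nat.blt (VL.getD (ix0 + i') 0) V || domXT (ix0 + i') V g x

/-- every sorted candidate shape of the volumes `V, …, V + n − 1` is dominated at the extra entries (`domXTall`) -/
def domXTV : ℕ → ℕ → Bool
  | 0, _ => true
  | n + 1, V => (triplesS V).all (domXTall V (gainOfTBV V)) && domXTV n (V + 1)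

/-- the extra entries have parameters `≥ 3` and positive denominators -/
def xdenOK : Bool :=
  (List.range (nl - ix0)).all fun i' => (List.range (nb - jx0)).all fun j' =>
    (xrow (ix0 + i') (jx0 + j')).all fun e => Nat.ble 3 e.1 && Nat.ble 1 e.2.2

/-- Structural facts about the data, all checked by evaluation: every row has `nb` entries; all denominators are positive; the vM fraction is
monotone in the level and in the bucket, the U11-G fraction is monotone in the level; `TB[0] = 1`, `TB` is increasing with `TB[j+1] ≤ 2·TB[j]`
and (`TB[j] ≤ 1` or `TB[j+1] ≤ TB[j]²`); `TP[j] = TB[j]` or `19 ≤ TP[j]`, and `TP[j] ≤ TB[j]`. -/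
def monoOK (nl nb : ℕ) : Bool :=
  Nat.beq (tb 0) 1 &&
  (List.range nl).all (fun i => Nat.beq (E.getD i []).length nb &&
    (List.range nb).all (fun j =>
      Nat.ble 1 (ent i j).2.1 && Nat.ble 1 (ent i j).2.2.2 &&
      (Nat.ble (nl - 1) i || (leP (ent i j) (ent (i + 1) j) && leW (ent i j) (ent (i + 1) j))) &&
      (Nat.ble (nb - 1) j || leP (ent i j) (ent i (j + 1))))) &&
  (List.range nb).all (fun j => Nat.blt (tb j) (tb (j + 1)) && Nat.ble (tb (j + 1)) (2 * tb j) &&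
    (Nat.ble (tb j) 1 || Nat.ble (tb (j + 1)) (tb j * tb j)) &&
    (Nat.beq (tp j) (tb j) || Nat.ble 19 (tp j)) && Nat.ble (tp j) (tb j))

/-! ## The checks (data-free parts reused from `TAStat`) -/

/-- Walk the buckets `j, j+1, …` of a table row (the row dropped to index `j`) for a maximal member (gain `g`, pair-product sum `p`, volume `V`, excess `d`,
smallest size `al`, least pair product `tl`) whose own bucket is `j0`: `TAStatKM.walk4` with this range's data — escape by `tiOK V (TB[j])`, else the
one-member `cover` at `t = TB[j]` or the multi-parameter k-member tree `TAStatKM.coverKX` (complete bucket lists `M2`, full row `rowOf V`, extra entries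
`xrowOf V`, at most `kmax` explicit members). -/
def walk (g p V d al tl L H j0 : ℕ) (row : List Entry) (j : ℕ) : Bool :=
  TAStatKM.walk4 tb m2l gainOfTBV (rowOf V) (xrowOf V) tp g p V d al tl kmax L H j0 row j

/-- The check of one sorted candidate shape `x` of volume `V` (gain `g`) as the maximal-volume member, for the orders `max(Lo, V+1) … Hi` (an order sub-range `[Lo, Hi]` of `[lo, Mtop]`; tree-heavy volumes are kernel-checked on several sub-ranges) and all
buckets from that of `x.1·x.2.1` on (smallest size `x.1`, least pair product `x.1·x.2.1` for the tree's `l`-source test). -/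
def checkShape (Lo Hi V g : ℕ) (x : ℕ × ℕ × ℕ) : Bool :=
  Nat.blt Hi (max Lo (V + 1)) ||
    walk g (us x) V (2 * us x - (x.1 + x.2.1 + x.2.2)) x.1 (x.1 * x.2.1) (max Lo (V + 1)) Hi (bucketOf (x.1 * x.2.1))
      ((E.getD (levOf V) []).drop (bucketOf (x.1 * x.2.1))) (bucketOf (x.1 * x.2.1))

/-- every sorted candidate shape of the volumes `V, …, V + n − 1` passes `checkShape` on the orders `[Lo, Hi]` -/
def checkV (Lo Hi : ℕ) : ℕ → ℕ → Bool
  | 0, _ => true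
  | n + 1, V => (triplesS V).all (checkShape Lo Hi V (gainOfTBV V)) && checkV Lo Hi n (V + 1)

/-- completeness of the second-member lists on the volumes `V, …, V + n − 1`: every sorted candidate shape whose bucket is flagged is listed there -/
def m2V : ℕ → ℕ → Bool
  | 0, _ => true
  | n + 1, V => (triplesS V).all (fun x => !(m2f (bucketOf (x.1 * x.2.1))) || (m2l (bucketOf (x.1 * x.2.1))).elem x) && m2V n (V + 1)

/-! ## Specification vocabulary of the soundness proof (checker-internal predicates, no claims) -/

/-- Sorted candidate shapes: `1 ≤ a ≤ b ≤ c` and the single-member table at order `Mtop`. [bookkeeping] -/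
def SCand (x : ℕ × ℕ × ℕ) : Prop :=
  1 ≤ x.1 ∧ x.1 ≤ x.2.1 ∧ x.2.1 ≤ x.2.2 ∧ tableOK Mtop x.1 x.2.1 x.2.2 = true

end Summit.MatrixMultiplication.MatrixMultiplication.Theorems.TB5Stat
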